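import Mathlib
import Summits.Ventures.PercRepro2.Defs
import Summits.Ventures.PercRepro2.Independence
import Summits.Ventures.PercRepro2.Harris
import Summits.Ventures.PercRepro2.Graph
import Summits.Ventures.PercRepro2.Exploration
import Summits.Ventures.PercRepro2.Events
import Summits.Ventures.PercRepro2.Induced
import Summits.Ventures.PercRepro2.BHKAvoid
import Summits.Ventures.PercRepro2.GateCylinder
import Summits.Ventures.PercRepro2.CCTRootEdge
import Summits.Ventures.PercRepro2.OneRootDropMono
import Summits.Ventures.PercRepro2.AvoidMono
import Summits.Ventures.PercRepro2.CDAvoidAnti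

/-!
# One pinning step along a route (blind cell PercRepro2, mine-a g34; MINE-A.md §89.7,
proofs/MINEA-CD-NESTED.md §2 (B))

The reusable core of the nested-routes theorem, in the vocabulary of forced edge sets
(`GateCylinder.forceOpen p B`).  Say `S` is JOINED by `B` if every configuration with the edges of `B`
open connects every vertex of `S` to `a₁` (stated inline as a hypothesis, no definition).  Then under
the forced vector `p[B ↦ 1]` the event `Q = {a₁ ↮ a₂}` is the avoidance event `{a₂ ↮ S}`
(`prob_inter_Q_eq_avoid`), and pinning one more edge `e = {v, y}` with `v ∈ S` open

* raises `P(U ∣ Q)` for every up-set `U` of `C₁` (`step_beta`, mine-c g30's `AvoidMono.avoid_mono`),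
* lowers `P(o ∈ C₂ ∣ Q)` (`step_gamma`, `CDAvoidAnti.avoid_anti`),
* and keeps `S ∪ {y}` joined (`joined_insert`),

all in cleared form (`P_B(Q U) · P_{B+e}(Q) ≤ P_{B+e}(Q U) · P_B(Q)`, `P_{B+e}(Q f) · P_B(Q) ≤
P_B(Q f) · P_{B+e}(Q)`).  Iterated along a route these are the cross-world monotonicities of
proofs/MINEA-CD-NESTED.md §2 (B) for routes of any length.  No definition; one seat.
-/

namespace Summit.Ventures.PercRepro2

namespace CDNestedStep

section Joined

variable {V : Type*} {E : Type*} [DecidableEq E] [DecidableEq V]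

omit [DecidableEq E] [DecidableEq V] in
/-- The singleton `{a₁}` is joined by any edge set. -/
lemma joined_singleton (ends : E → Sym2 V) (B : Finset E) (a₁ : V) :
    ∀ ω : Config E, ω ∈ GateCylinder.cylinder B → ∀ v ∈ ({a₁} : Finset V), Conn ends ω a₁ v := by
  intro ω _ v hv
  rw [Finset.mem_singleton] at hv
  subst hv
  exact conn_refl _ _ _

/-- Pinning an edge `e = {v, y}` at a joined vertex `v` joins `y` as well. -/
lemma joined_insert {ends : E → Sym2 V} {B : Finset E} {a₁ : V} {S : Finset V}
    (h : ∀ ω : Config E, ω ∈ GateCylinder.cylinder B → ∀ v ∈ S, Conn ends ω a₁ v) {e : E} {v y : V}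
    (hends : ends e = s(v, y)) (hv : v ∈ S) :
    ∀ ω : Config E, ω ∈ GateCylinder.cylinder (insert e B) → ∀ z ∈ insert y S, Conn ends ω a₁ z := by
  intro ω hω z hz
  have hB : ω ∈ GateCylinder.cylinder B := fun e' he' => hω e' (Finset.mem_insert_of_mem he')
  rw [Finset.mem_insert] at hz
  rcases hz with rfl | hz
  · have hv' : Conn ends ω a₁ v := h ω hB v hv
    have he : ω e = true := hω e (Finset.mem_insert_self e B)
    exact conn_trans hv' (conn_of_openAdj ⟨e, he, hends⟩)
  · exact h ω hB z hz

end Joined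

section Step

variable {V : Type*} {E : Type*} [Fintype E] [DecidableEq E] [Fintype V] [DecidableEq V]
  {R : Type*} [Field R] [LinearOrder R] [IsStrictOrderedRing R]

omit [Fintype E] [Fintype V] [DecidableEq V] [LinearOrder R] [IsStrictOrderedRing R] in
/-- `forceOpen p (insert e B) = (forceOpen p B)[e ↦ 1]`. -/
lemma forceOpen_insert (p : E → R) (B : Finset E) (e : E) :
    GateCylinder.forceOpen p (insert e B) = Function.update (GateCylinder.forceOpen p B) e 1 := by
  funext e'
  by_cases h : e' = e
  · subst h; simp [GateCylinder.forceOpen]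
  · simp [GateCylinder.forceOpen, h]

omit [Fintype V] [DecidableEq V] [LinearOrder R] [IsStrictOrderedRing R] in
/-- **Under a forced vector, `Q` is the avoidance of any joined set containing `a₁`.** -/
lemma prob_inter_Q_eq_avoid (p : E → R) {ends : E → Sym2 V} {B : Finset E} {a₁ a₂ : V}
    {S : Finset V} (hJ : ∀ ω : Config E, ω ∈ GateCylinder.cylinder B → ∀ v ∈ S, Conn ends ω a₁ v)
    (ha₁ : a₁ ∈ S) (X : Set (Config E)) :
    prob (GateCylinder.forceOpen p B) (X ∩ (connEvent ends a₁ a₂)ᶜ) =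
      prob (GateCylinder.forceOpen p B) (X ∩ avoidAll ends a₂ S) := by
  unfold prob
  refine Finset.sum_congr rfl fun ω _ => ?_
  by_cases hω : ω ∈ GateCylinder.cylinder B
  · have hiff : ω ∈ X ∩ (connEvent ends a₁ a₂)ᶜ ↔ ω ∈ X ∩ avoidAll ends a₂ S := by
      simp only [Set.mem_inter_iff, Set.mem_compl_iff, mem_connEvent, mem_avoidAll]
      constructor
      · rintro ⟨hX, hQ⟩
        refine ⟨hX, fun v hv hc => hQ ?_⟩
        exact conn_trans (hJ ω hω v hv) (conn_symm hc)
      · rintro ⟨hX, hA⟩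
        exact ⟨hX, fun hc => hA a₁ ha₁ (conn_symm hc)⟩
    by_cases h1 : ω ∈ X ∩ (connEvent ends a₁ a₂)ᶜ
    · rw [Set.indicator_of_mem h1, Set.indicator_of_mem (hiff.1 h1)]
    · rw [Set.indicator_of_notMem h1, Set.indicator_of_notMem (fun h => h1 (hiff.2 h))]
  · have hz := GateCylinder.weight_forceOpen_of_notMem_cylinder p B hω
    rw [Set.indicator_apply_eq_zero.2 (fun _ => hz), Set.indicator_apply_eq_zero.2 (fun _ => hz)]

omit [Fintype V] [DecidableEq V] [LinearOrder R] [IsStrictOrderedRing R] in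
/-- `prob_inter_Q_eq_avoid` with `X = univ`. -/
lemma prob_Q_eq_avoid (p : E → R) {ends : E → Sym2 V} {B : Finset E} {a₁ a₂ : V}
    {S : Finset V} (hJ : ∀ ω : Config E, ω ∈ GateCylinder.cylinder B → ∀ v ∈ S, Conn ends ω a₁ v)
    (ha₁ : a₁ ∈ S) :
    prob (GateCylinder.forceOpen p B) (connEvent ends a₁ a₂)ᶜ =
      prob (GateCylinder.forceOpen p B) (avoidAll ends a₂ S) := by
  have := prob_inter_Q_eq_avoid p (a₂ := a₂) hJ ha₁ Set.univ
  simpa using this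

omit [Fintype E] [Fintype V] [DecidableEq V] in
/-- A configuration is below itself with an edge opened. -/
lemma le_update_true' (ω : Config E) (e : E) : ω ≤ Function.update ω e true := by
  intro e'
  by_cases h : e' = e
  · subst h; simp
  · simp [Function.update_of_ne h]

omit [Fintype V] [DecidableEq V] in
/-- Pinning an edge open shrinks an avoidance event. -/
lemma prob_update_one_avoid_le' (p : E → R) (hp : IsProbVec p) {ends : E → Sym2 V} (e : E) (a₂ : V)
    (S : Finset V) :
    prob (Function.update p e 1) (avoidAll ends a₂ S) ≤ prob p (avoidAll ends a₂ S) := by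
  rw [CCT.prob_update_one_eq]
  refine prob_mono hp fun ω hω => ?_
  simp only [Set.mem_setOf_eq] at hω
  intro x hx hc
  exact hω x hx (conn_mono (le_update_true' ω e) hc)

/-- **One step, `β`**: pinning `e = {v, y}` open at a joined vertex `v ∈ S` raises `P(U ∣ Q)`:
`P_B(Q U) · P_{B+e}(Q) ≤ P_{B+e}(Q U) · P_B(Q)`. -/
theorem step_beta (p : E → R) (hp : IsProbVec p) {ends : E → Sym2 V} {B : Finset E} {a₁ a₂ : V}
    {S : Finset V} (hJ : ∀ ω : Config E, ω ∈ GateCylinder.cylinder B → ∀ v ∈ S, Conn ends ω a₁ v)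
    (ha₁ : a₁ ∈ S) {e : E} {v y : V} (hends : ends e = s(v, y)) (hv : v ∈ S)
    {𝓔 : Set (Set V)} (h𝓔 : IsUpperSet 𝓔) :
    prob (GateCylinder.forceOpen p B) ((connEvent ends a₁ a₂)ᶜ ∩ clusterInEvent ends a₁ 𝓔) *
        prob (GateCylinder.forceOpen p (insert e B)) (connEvent ends a₁ a₂)ᶜ ≤
      prob (GateCylinder.forceOpen p (insert e B))
          ((connEvent ends a₁ a₂)ᶜ ∩ clusterInEvent ends a₁ 𝓔) *
        prob (GateCylinder.forceOpen p B) (connEvent ends a₁ a₂)ᶜ := by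
  set q := GateCylinder.forceOpen p B with hq
  have hqp : IsProbVec q := GateCylinder.isProbVec_forceOpen hp B
  have hq'p : IsProbVec (Function.update q e 1) := hqp.update e zero_le_one le_rfl
  have hJ' : ∀ ω : Config E, ω ∈ GateCylinder.cylinder (insert e B) → ∀ v ∈ S, Conn ends ω a₁ v :=
    fun ω hω => hJ ω fun e' he' => hω e' (Finset.mem_insert_of_mem he')
  rw [forceOpen_insert, ← hq]
  set Q := (connEvent ends a₁ a₂)ᶜ with hQ
  set U := clusterInEvent ends a₁ 𝓔 with hU
  -- the conversions
  have c0 : prob q (Q ∩ U) = prob q (U ∩ avoidAll ends a₂ S) := by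
    rw [Set.inter_comm, hq, prob_inter_Q_eq_avoid p hJ ha₁]
  have c0' : prob q Q = prob q (avoidAll ends a₂ S) := by rw [hq, prob_Q_eq_avoid p hJ ha₁]
  have c1 : prob (Function.update q e 1) (Q ∩ U) =
      prob (Function.update q e 1) (U ∩ avoidAll ends a₂ S) := by
    rw [Set.inter_comm, hq, ← forceOpen_insert, prob_inter_Q_eq_avoid p hJ' ha₁]
  have c1' : prob (Function.update q e 1) Q = prob (Function.update q e 1) (avoidAll ends a₂ S) := by
    rw [hq, ← forceOpen_insert, prob_Q_eq_avoid p hJ' ha₁]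
  have hD₀ : 0 ≤ prob q Q := prob_nonneg hqp _
  have hD₁ : 0 ≤ prob (Function.update q e 1) Q := prob_nonneg hq'p _
  rcases hD₀.lt_or_eq with hD₀ | hD₀
  · rcases hD₁.lt_or_eq with hD₁ | hD₁
    · have key := AvoidMono.avoid_mono q ends hqp hends a₁ a₂ (S := S) ha₁ hv h𝓔 (s := q e) (t := 1)
        (hqp.le_one e) (by rw [Function.update_eq_self, ← c0']; exact hD₀) (by rw [← c1']; exact hD₁)
      rw [Function.update_eq_self, ← c0, ← c0', ← c1, ← c1', div_le_div_iff₀ hD₀ hD₁] at key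
      linarith [key]
    · rw [← hD₁]
      have h0 : prob (Function.update q e 1) (Q ∩ U) = 0 :=
        le_antisymm (hD₁ ▸ prob_mono hq'p Set.inter_subset_left) (prob_nonneg hq'p _)
      rw [h0]
      simp
  · have h0 : prob q (Q ∩ U) = 0 :=
      le_antisymm (hD₀ ▸ prob_mono hqp Set.inter_subset_left) (prob_nonneg hqp _)
    rw [h0, ← hD₀]
    simp

/-- **One step, `γ`**: pinning `e = {v, y}` open at a joined vertex `v ∈ S` lowers `P(o ∈ C₂ ∣ Q)`:
`P_{B+e}(Q f) · P_B(Q) ≤ P_B(Q f) · P_{B+e}(Q)`. -/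
theorem step_gamma (p : E → R) (hp : IsProbVec p) {ends : E → Sym2 V} {B : Finset E} {a₁ a₂ o : V}
    {S : Finset V} (hJ : ∀ ω : Config E, ω ∈ GateCylinder.cylinder B → ∀ v ∈ S, Conn ends ω a₁ v)
    (ha₁ : a₁ ∈ S) {e : E} {v y : V} (hends : ends e = s(v, y)) (hv : v ∈ S) :
    prob (GateCylinder.forceOpen p (insert e B)) ((connEvent ends a₁ a₂)ᶜ ∩ connEvent ends a₂ o) *
        prob (GateCylinder.forceOpen p B) (connEvent ends a₁ a₂)ᶜ ≤
      prob (GateCylinder.forceOpen p B) ((connEvent ends a₁ a₂)ᶜ ∩ connEvent ends a₂ o) *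
        prob (GateCylinder.forceOpen p (insert e B)) (connEvent ends a₁ a₂)ᶜ := by
  set q := GateCylinder.forceOpen p B with hq
  have hqp : IsProbVec q := GateCylinder.isProbVec_forceOpen hp B
  have hq'p : IsProbVec (Function.update q e 1) := hqp.update e zero_le_one le_rfl
  have hJ' : ∀ ω : Config E, ω ∈ GateCylinder.cylinder (insert e B) → ∀ v ∈ S, Conn ends ω a₁ v :=
    fun ω hω => hJ ω fun e' he' => hω e' (Finset.mem_insert_of_mem he')
  rw [forceOpen_insert, ← hq]
  set Q := (connEvent ends a₁ a₂)ᶜ with hQ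
  set f := connEvent ends a₂ o with hf
  have c0 : prob q (Q ∩ f) = prob q (f ∩ avoidAll ends a₂ S) := by
    rw [Set.inter_comm, hq, prob_inter_Q_eq_avoid p hJ ha₁]
  have c0' : prob q Q = prob q (avoidAll ends a₂ S) := by rw [hq, prob_Q_eq_avoid p hJ ha₁]
  have c1 : prob (Function.update q e 1) (Q ∩ f) =
      prob (Function.update q e 1) (f ∩ avoidAll ends a₂ S) := by
    rw [Set.inter_comm, hq, ← forceOpen_insert, prob_inter_Q_eq_avoid p hJ' ha₁]
  have c1' : prob (Function.update q e 1) Q = prob (Function.update q e 1) (avoidAll ends a₂ S) := by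
    rw [hq, ← forceOpen_insert, prob_Q_eq_avoid p hJ' ha₁]
  have hD₀ : 0 ≤ prob q Q := prob_nonneg hqp _
  have hD₁ : 0 ≤ prob (Function.update q e 1) Q := prob_nonneg hq'p _
  rcases hD₀.lt_or_eq with hD₀ | hD₀
  · rcases hD₁.lt_or_eq with hD₁ | hD₁
    · have key := CDAvoidAnti.avoid_anti q hqp hends a₂ o (S := S) hv (s := q e) (t := 1)
        (hqp.le_one e) (by rw [Function.update_eq_self, ← c0']; exact hD₀) (by rw [← c1']; exact hD₁)
      rw [Function.update_eq_self, ← c0, ← c0', ← c1, ← c1', div_le_div_iff₀ hD₁ hD₀] at key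
      linarith [key]
    · rw [← hD₁]
      have h0 : prob (Function.update q e 1) (Q ∩ f) = 0 :=
        le_antisymm (hD₁ ▸ prob_mono hq'p Set.inter_subset_left) (prob_nonneg hq'p _)
      rw [h0]
      simp
  · have h0 : prob q (Q ∩ f) = 0 :=
      le_antisymm (hD₀ ▸ prob_mono hqp Set.inter_subset_left) (prob_nonneg hqp _)
    rw [h0, ← hD₀]
    simp

end Step

end CDNestedStep

end Summit.Ventures.PercRepro2
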